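import Literature.RingTheory.FittingIdeal.Hypersurface
import Mathlib.RingTheory.MvPolynomial.Ideal
import Mathlib.RingTheory.DiscreteValuationRing.Basic
import Mathlib.RingTheory.Length
import HarnessLib

/-!
# The singular scheme of de Jong's model algebra `B' = A'[u, v]/(Q - h)` and its length (de Jong 1996, 2.23, 3.3)

Topic: `Literature/AlgebraicGeometry/Resolution`. De Jong 1996, 3.3 computes at a singular point of
a semi-stable curve through the finite-type MODEL of its complete local ring: "`B ≅ A'⟦u, v⟧/
(Q - t₁^{n₁} ⋯ t_r^{n_r})`. We remark that `B` is the completion of the algebra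
`B' = A'[u, v]/(Q - t₁^{n₁} ⋯ t_r^{n_r})` at the maximal ideal `𝔪_{A'}B' + (u, v)B'`. For questions
which are not sensitive to completion, we may compute using the algebra `B'`." The question of
3.4 — the invariant `n_T`, the length of the singular scheme `Sing(f)` (2.21: "the closed
subscheme defined by the first Fitting ideal of the sheaf `Ω_{X/S}`") at the generic point of
`T`, cf. `Scheme.Hom.nodeThickness` (`AlterationsSemiStableThickness.lean`) — is such a
question, and this file settles it ON THE MODEL, all PROVED:

* `DeJong1996.nodalModelRelation a b c h = a u² + b uv + c v² - h ∈ A[u, v]` and the model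
  algebra `DeJong1996.NodalModelRing a b c h = A[u, v]/(Q - h)` (3.3; `u = X 0`, `v = X 1`);
* `DeJong1996.fittingIdeal_kaehlerDifferential_nodalModelRing` — **2.23: "the trace of `Sing(f)`
  on the scheme `Spec B` is given by the ideal `(u, v) ⊂ B`"**: if the discriminant `b² - 4ac`
  of `Q` is a unit ("nonvanishing discriminant", read in the local ring `A'`), then
  `Fitt₁(Ω_{B'/A}) = (ū, v̄)` — the Jacobian ideal `(Q_u, Q_v)` of the hypersurface
  (`Module.fittingIdeal_kaehlerDifferential_quotient_span_singleton`, `Hypersurface.lean`)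
  equals `(u, v)` because the matrix `[[2a, b], [b, 2c]]` of the linear forms `Q_u, Q_v` has unit
  determinant `4ac - b²`;
* `DeJong1996.nodalModelRingQuotientEquiv` — **"This lies over the closed subscheme of `Spec A`
  given by the element `h`"**: `B'/(ū, v̄) ≅ A/(h)` (`A[u, v]/(Q - h, u, v) = A/(Q(0, 0) - h)`);
* `DeJong1996.length_quotient_fittingIdeal_nodalModelRing` — hence
  `ℓ_{B'}(B'/Fitt₁(Ω_{B'/A})) = ℓ_A(A/(h))`, and
  `DeJong1996.length_quotient_fittingIdeal_nodalModelRing_eq` — **3.4: `n_T = n₁`**: for `A` a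
  discrete valuation ring with uniformizer `t` and `h = t^m` the length is `m` ("the complete
  local ring of `T` at `x` corresponds to the quotient map `B → A'/t₁A'` … an invariant `n_T`").

What remains for `DeJong1996NodeLocalStructureCodimTwo` / `DeJong1996SemiStableThickness` on the
scheme side is the passage from `𝒪_{X,η_T}` to the model (2.23, 3.3), along which `Fitt₁(Ω)`
is transported by `Module.fittingIdeal_baseChange` (`BaseChange.lean`).

## Sources

* A. J. de Jong, *Smoothness, semi-stability and alterations*, Publ. Math. IHÉS 83 (1996), 2.21,
  2.23 (pp. 61–62), 3.3–3.4 (p. 63). [DeJong1996]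
* D. Eisenbud, *Commutative Algebra with a View Toward Algebraic Geometry*, GTM 150 (1995),
  §16.1, §20.2, via `Literature/RingTheory/FittingIdeal/Hypersurface.lean`.
-/

noncomputable section

namespace Literature.AlgebraicGeometry.Resolution

universe u

open MvPolynomial Literature.RingTheory.FittingIdeal IsLocalRing

namespace DeJong1996

variable {A : Type u} [CommRing A]

/-! ## The model algebra -/

/-- **De Jong's relation `Q(u, v) - h`** in `A[u, v] = MvPolynomial (Fin (1 + 1)) A` (`u = X 0`,
`v = X 1`), `Q = a u² + b uv + c v²` a binary quadratic form over `A` and `h ∈ A` (2.23: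
"Choose an arbitrary lift `Q = A₀u² + A₁uv + A₂v² ∈ A'[u, v]` of `q(u, v)` … we may assume
`h ∈ A'`"; 3.3: `h = t₁^{n₁} ⋯ t_r^{n_r}` after changing `Q` into `ε⁻¹Q`).
[cite: DeJong1996, 2.23 and 3.3, pp. 61–63] -/
def nodalModelRelation (a b c h : A) : MvPolynomial (Fin (1 + 1)) A :=
  C a * X 0 ^ 2 + C b * (X 0 * X 1) + C c * X 1 ^ 2 - C h

/-- **De Jong's model algebra `B' = A[u, v]/(Q - h)`** (3.3: "`B` is the completion of the
algebra `B' = A'[u, v]/(Q - t₁^{n₁} ⋯ t_r^{n_r})` at the maximal ideal `𝔪_{A'}B' + (u, v)B'`. For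
questions which are not sensitive to completion, we may compute using the algebra `B'`").
[cite: DeJong1996, 3.3, p. 63] -/
abbrev NodalModelRing (a b c h : A) : Type u :=
  MvPolynomial (Fin (1 + 1)) A ⧸ Ideal.span {nodalModelRelation a b c h}

/-- The partial derivative `Q_u = 2a u + b v` of the relation. [folklore] -/
theorem pderiv_zero_nodalModelRelation (a b c h : A) :
    MvPolynomial.pderiv 0 (nodalModelRelation a b c h) = C (2 * a) * X 0 + C b * X 1 := by
  simp only [nodalModelRelation, map_sub, map_add, Derivation.leibniz, Derivation.leibniz_pow,
    pderiv_C, pderiv_X_self, pderiv_X_of_ne (show (1 : Fin (1 + 1)) ≠ 0 from by decide),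
    smul_zero, zero_add, add_zero, mul_zero, smul_eq_mul, mul_one, sub_zero, map_mul, map_ofNat,
    nsmul_eq_mul]
  ring

/-- The partial derivative `Q_v = b u + 2c v` of the relation. [folklore] -/
theorem pderiv_one_nodalModelRelation (a b c h : A) :
    MvPolynomial.pderiv 1 (nodalModelRelation a b c h) = C b * X 0 + C (2 * c) * X 1 := by
  simp only [nodalModelRelation, map_sub, map_add, Derivation.leibniz, Derivation.leibniz_pow,
    pderiv_C, pderiv_X_self, pderiv_X_of_ne (show (0 : Fin (1 + 1)) ≠ 1 from by decide),
    smul_zero, zero_add, add_zero, mul_zero, smul_eq_mul, mul_one, sub_zero, map_mul, map_ofNat,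
    nsmul_eq_mul]
  ring

/-- The constant term of `Q - h` is `-h`. [folklore] -/
theorem constantCoeff_nodalModelRelation (a b c h : A) :
    constantCoeff (nodalModelRelation a b c h) = -h := by
  simp [nodalModelRelation, constantCoeff_X, constantCoeff_C]

/-- `Q = (Q - h) + h` has no constant term: it lies in the ideal `(u, v)` of the variables.
[folklore] -/
theorem nodalModelRelation_add_C_mem_idealOfVars (a b c h : A) :
    nodalModelRelation a b c h + C h ∈ idealOfVars (Fin (1 + 1)) A := by
  have hu : (X 0 : MvPolynomial (Fin (1 + 1)) A) ∈ idealOfVars (Fin (1 + 1)) A :=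
    Ideal.subset_span ⟨0, rfl⟩
  have hv : (X 1 : MvPolynomial (Fin (1 + 1)) A) ∈ idealOfVars (Fin (1 + 1)) A :=
    Ideal.subset_span ⟨1, rfl⟩
  have he : nodalModelRelation a b c h + C h =
      (C a * X 0) * X 0 + (C b * X 0) * X 1 + (C c * X 1) * X 1 := by
    simp only [nodalModelRelation]
    ring
  rw [he]
  exact Ideal.add_mem _ (Ideal.add_mem _ (Ideal.mul_mem_left _ _ hu) (Ideal.mul_mem_left _ _ hv))
    (Ideal.mul_mem_left _ _ hv)

/-! ## The Jacobian ideal of a nondegenerate quadratic form is `(u, v)` -/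

/-- **Linear algebra of the node**: if `b² - 4ac` is a unit, the linear forms `Q_u = 2a u + b v`
and `Q_v = b u + 2c v` generate the same ideal as `u, v` — their coefficient matrix
`[[2a, b], [b, 2c]]` has determinant `4ac - b²`. [folklore] -/
theorem span_pderiv_nodalModelRelation_eq (a b c : A) (hd : IsUnit (b ^ 2 - 4 * a * c)) :
    (Ideal.span {C (2 * a) * X 0 + C b * X 1, C b * X 0 + C (2 * c) * X 1} :
        Ideal (MvPolynomial (Fin (1 + 1)) A)) =
      Ideal.span {X 0, X 1} := by
  apply le_antisymm
  · rw [Ideal.span_le]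
    have hu : (X 0 : MvPolynomial (Fin (1 + 1)) A) ∈ Ideal.span {(X 0 : MvPolynomial _ A), X 1} :=
      Ideal.subset_span (Set.mem_insert _ _)
    have hv : (X 1 : MvPolynomial (Fin (1 + 1)) A) ∈ Ideal.span {(X 0 : MvPolynomial _ A), X 1} :=
      Ideal.subset_span (Set.mem_insert_of_mem _ rfl)
    rintro p (rfl | rfl)
    · exact Ideal.add_mem _ (Ideal.mul_mem_left _ _ hu) (Ideal.mul_mem_left _ _ hv)
    · exact Ideal.add_mem _ (Ideal.mul_mem_left _ _ hu) (Ideal.mul_mem_left _ _ hv)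
  · -- `d = 4ac - b²` is a unit, and `d u = 2c Q_u - b Q_v`, `d v = 2a Q_v - b Q_u`
    obtain ⟨d, hdd⟩ : ∃ d : A, d * (4 * a * c - b ^ 2) = 1 := by
      obtain ⟨w, hw⟩ := hd.neg.exists_left_inv
      exact ⟨w, by rw [← hw]; ring⟩
    set Qu : MvPolynomial (Fin (1 + 1)) A := C (2 * a) * X 0 + C b * X 1 with hQu
    set Qv : MvPolynomial (Fin (1 + 1)) A := C b * X 0 + C (2 * c) * X 1 with hQv
    have hQu' : Qu ∈ Ideal.span {Qu, Qv} := Ideal.subset_span (Set.mem_insert _ _)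
    have hQv' : Qv ∈ Ideal.span {Qu, Qv} := Ideal.subset_span (Set.mem_insert_of_mem _ rfl)
    have hX0 : (X 0 : MvPolynomial (Fin (1 + 1)) A) =
        C d * (C (2 * c) * Qu - C b * Qv) := by
      have h1 : C (2 * c) * Qu - C b * Qv = C (4 * a * c - b ^ 2) * X 0 := by
        simp only [hQu, hQv, map_mul, map_sub, map_pow, map_ofNat]
        ring
      rw [h1, ← mul_assoc, ← map_mul, hdd, map_one, one_mul]
    have hX1 : (X 1 : MvPolynomial (Fin (1 + 1)) A) =
        C d * (C (2 * a) * Qv - C b * Qu) := by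
      have h1 : C (2 * a) * Qv - C b * Qu = C (4 * a * c - b ^ 2) * X 1 := by
        simp only [hQu, hQv, map_mul, map_sub, map_pow, map_ofNat]
        ring
      rw [h1, ← mul_assoc, ← map_mul, hdd, map_one, one_mul]
    rw [Ideal.span_le]
    rintro p (rfl | rfl)
    · rw [SetLike.mem_coe, hX0]
      exact Ideal.mul_mem_left _ _ (Ideal.sub_mem _ (Ideal.mul_mem_left _ _ hQu')
        (Ideal.mul_mem_left _ _ hQv'))
    · rw [SetLike.mem_coe, hX1]
      exact Ideal.mul_mem_left _ _ (Ideal.sub_mem _ (Ideal.mul_mem_left _ _ hQv')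
        (Ideal.mul_mem_left _ _ hQu'))

/-- **de Jong 1996, 2.23: the singular scheme of the model algebra is `V(u, v)`** ("the trace of
`Sing(f)` on the scheme `Spec B` is given by the ideal `(u, v) ⊂ B`"): for `B' = A[u, v]/(Q - h)`
with `disc(Q) = b² - 4ac` a unit, the first Fitting ideal of `Ω_{B'/A}` — the ideal of the
singular scheme, 2.21 — is `(ū, v̄)`: it is the Jacobian ideal `(Q_u, Q_v)` of the hypersurface
(`Module.fittingIdeal_kaehlerDifferential_quotient_span_singleton`), and `(Q_u, Q_v) = (u, v)`.
[cite: DeJong1996, 2.23, p. 62] -/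
theorem fittingIdeal_kaehlerDifferential_nodalModelRing (a b c h : A)
    (hd : IsUnit (b ^ 2 - 4 * a * c)) :
    Module.fittingIdeal (NodalModelRing a b c h) (Ω[NodalModelRing a b c h⁄A]) 1 =
      Ideal.span {Ideal.Quotient.mk _ (X 0), Ideal.Quotient.mk _ (X 1)} := by
  rw [Module.fittingIdeal_kaehlerDifferential_quotient_span_singleton]
  have hr : (Set.range fun i : Fin (1 + 1) => Ideal.Quotient.mk
      (Ideal.span {nodalModelRelation a b c h}) (MvPolynomial.pderiv i (nodalModelRelation a b c h))) =
      Ideal.Quotient.mk (Ideal.span {nodalModelRelation a b c h}) ''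
        {C (2 * a) * X 0 + C b * X 1, C b * X 0 + C (2 * c) * X 1} := by
    ext q
    simp only [Set.mem_range, Set.mem_image, Set.mem_insert_iff, Set.mem_singleton_iff,
      exists_eq_or_imp, exists_eq_left]
    constructor
    · rintro ⟨i, rfl⟩
      refine Fin.cases ?_ (fun j => ?_) i
      · exact Or.inl (by rw [pderiv_zero_nodalModelRelation])
      · have hj : j = 0 := Fin.eq_zero j
        subst hj
        exact Or.inr (by
          rw [show Fin.succ (0 : Fin 1) = (1 : Fin (1 + 1)) from rfl, pderiv_one_nodalModelRelation])
    · rintro (rfl | rfl)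
      · exact ⟨0, by rw [pderiv_zero_nodalModelRelation]⟩
      · exact ⟨1, by rw [pderiv_one_nodalModelRelation]⟩
  rw [hr, ← Ideal.map_span, span_pderiv_nodalModelRelation_eq a b c hd, Ideal.map_span,
    Set.image_insert_eq, Set.image_singleton]

/-! ## `B'/(u, v) ≅ A/(h)` -/

/-- A polynomial with vanishing constant term lies in the ideal of the variables. [folklore] -/
theorem mem_idealOfVars_of_constantCoeff_eq_zero {σ : Type*} {p : MvPolynomial σ A}
    (hp : constantCoeff p = 0) : p ∈ idealOfVars σ A := by
  rw [← pow_one (idealOfVars σ A), mem_pow_idealOfVars_iff']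
  intro x hx
  have hx0 : x = 0 := by
    have h : Finsupp.degree x = 0 := Nat.lt_one_iff.mp hx
    exact (Finsupp.degree_eq_zero_iff x).mp h
  subst hx0
  exact hp

/-- The kernel of `A[u, v] → A → A/(h)` (constant term, then reduction) is `(Q - h) + (u, v)`.
[folklore] -/
theorem ker_mk_comp_constantCoeff (a b c h : A) :
    RingHom.ker ((Ideal.Quotient.mk (Ideal.span {h})).comp
        (constantCoeff : MvPolynomial (Fin (1 + 1)) A →+* A)) =
      Ideal.span {nodalModelRelation a b c h} ⊔ idealOfVars (Fin (1 + 1)) A := by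
  apply le_antisymm
  · intro p hp
    rw [RingHom.mem_ker, RingHom.comp_apply, Ideal.Quotient.eq_zero_iff_mem,
      Ideal.mem_span_singleton'] at hp
    obtain ⟨r, hr⟩ := hp
    -- `p = (p - C p₀) + C (r h)`, `C (r h) = C r · (Q - (Q - h))`
    have hp1 : p - C (constantCoeff p) ∈ idealOfVars (Fin (1 + 1)) A :=
      mem_idealOfVars_of_constantCoeff_eq_zero (by simp)
    have hp2 : C (constantCoeff p) ∈
        Ideal.span {nodalModelRelation a b c h} ⊔ idealOfVars (Fin (1 + 1)) A := by
      rw [← hr, map_mul]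
      have he : (C h : MvPolynomial (Fin (1 + 1)) A) =
          (nodalModelRelation a b c h + C h) - nodalModelRelation a b c h := by ring
      rw [he, mul_sub]
      exact Ideal.sub_mem _
        (Ideal.mem_sup_right (Ideal.mul_mem_left _ _ (nodalModelRelation_add_C_mem_idealOfVars a b c h)))
        (Ideal.mem_sup_left (Ideal.mul_mem_left _ _ (Ideal.mem_span_singleton_self _)))
    have he : p = (p - C (constantCoeff p)) + C (constantCoeff p) := by ring
    rw [he]
    exact Ideal.add_mem _ (Ideal.mem_sup_right hp1) hp2
  · refine sup_le ?_ ?_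
    · rw [Ideal.span_le, Set.singleton_subset_iff, SetLike.mem_coe, RingHom.mem_ker,
        RingHom.comp_apply, constantCoeff_nodalModelRelation, Ideal.Quotient.eq_zero_iff_mem]
      exact Submodule.neg_mem _ (Ideal.mem_span_singleton_self h)
    · rw [Ideal.span_le]
      rintro _ ⟨i, rfl⟩
      rw [SetLike.mem_coe, RingHom.mem_ker, RingHom.comp_apply, constantCoeff_X, map_zero]

/-- **de Jong 1996, 2.23: `V(u, v) ⊂ Spec B'` "lies over the closed subscheme of `Spec A` given by
the element `h`"** — indeed isomorphically: `B'/(ū, v̄) = A[u, v]/(Q - h, u, v) ≅ A/(h)`.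
[cite: DeJong1996, 2.23, p. 62] -/
def nodalModelRingQuotientEquiv (a b c h : A) :
    (NodalModelRing a b c h ⧸
        Ideal.span {Ideal.Quotient.mk (Ideal.span {nodalModelRelation a b c h}) (X 0),
          Ideal.Quotient.mk (Ideal.span {nodalModelRelation a b c h}) (X 1)}) ≃+*
      A ⧸ Ideal.span {h} := by
  refine (Ideal.quotEquivOfEq ?_).trans
    ((DoubleQuot.quotQuotEquivQuotSup (Ideal.span {nodalModelRelation a b c h})
      (idealOfVars (Fin (1 + 1)) A)).trans
      ((Ideal.quotEquivOfEq (ker_mk_comp_constantCoeff a b c h).symm).trans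
        (RingHom.quotientKerEquivOfSurjective ?_)))
  · rw [idealOfVars, Ideal.map_span]
    congr 1
    ext q
    simp only [Set.mem_insert_iff, Set.mem_singleton_iff, Set.mem_image, Set.mem_range,
      exists_exists_eq_and]
    constructor
    · rintro (rfl | rfl)
      · exact ⟨0, rfl⟩
      · exact ⟨1, rfl⟩
    · rintro ⟨i, rfl⟩
      refine Fin.cases (Or.inl rfl) (fun j => ?_) i
      have hj : j = 0 := Fin.eq_zero j
      subst hj
      exact Or.inr rfl
  · intro x
    obtain ⟨y, rfl⟩ := Ideal.Quotient.mk_surjective x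
    exact ⟨C y, by simp⟩

/-! ## The length: `n_T = n₁` on the model -/

/-- **The length of the singular scheme of the model**: `ℓ_{B'}(B'/Fitt₁(Ω_{B'/A})) = ℓ_A(A/(h))`
for `B' = A[u, v]/(Q - h)` with `disc(Q)` a unit (`B'/Fitt₁ = B'/(ū, v̄) ≅ A/(h)`).
[cite: DeJong1996, 2.23 and 3.3, pp. 62–63] -/
theorem length_quotient_fittingIdeal_nodalModelRing (a b c h : A)
    (hd : IsUnit (b ^ 2 - 4 * a * c)) :
    Module.length (NodalModelRing a b c h)
        (NodalModelRing a b c h ⧸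
          Module.fittingIdeal (NodalModelRing a b c h) (Ω[NodalModelRing a b c h⁄A]) 1) =
      Module.length A (A ⧸ Ideal.span {h}) := by
  rw [fittingIdeal_kaehlerDifferential_nodalModelRing a b c h hd]
  set J : Ideal (NodalModelRing a b c h) :=
    Ideal.span {Ideal.Quotient.mk (Ideal.span {nodalModelRelation a b c h}) (X 0),
      Ideal.Quotient.mk (Ideal.span {nodalModelRelation a b c h}) (X 1)} with hJ
  rw [Module.length_eq_of_surjective (S := NodalModelRing a b c h) (R := NodalModelRing a b c h ⧸ J)
      (M := NodalModelRing a b c h ⧸ J) Ideal.Quotient.mk_surjective,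
    Module.length_eq_of_surjective (S := A) (R := A ⧸ Ideal.span {h}) (M := A ⧸ Ideal.span {h})
      Ideal.Quotient.mk_surjective]
  -- the lengths of the isomorphic rings `B'/(ū, v̄) ≅ A/(h)` over themselves agree
  apply WithBot.coe_injective
  rw [Module.coe_length, Module.coe_length]
  exact Order.krullDim_eq_of_orderIso (Ideal.relIsoOfBijective (nodalModelRingQuotientEquiv a b c h)
    (nodalModelRingQuotientEquiv a b c h).bijective).symm

/-- **de Jong 1996, 3.4: `n_T = n₁` on the model.** For `A` a discrete valuation ring with
uniformizer `t` (at `η_T`: `A' ⊇ 𝒪̂_{S, η_{D₁}}`, 3.4), `Q` of unit discriminant and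
`h = t^m` (3.3 with `r = 1`), the singular scheme of `B' = A[u, v]/(Q - t^m)` has length `m`:
`ℓ_{B'}(B'/Fitt₁(Ω_{B'/A})) = ℓ_A(A/(t^m)) = m` ("the complete local ring of `T` at `x`
corresponds to the quotient map `B → A'/t₁A'` … This integer is … an invariant `n_T`").
[cite: DeJong1996, 3.4, p. 63] -/
theorem length_quotient_fittingIdeal_nodalModelRing_eq [IsDomain A] [IsDiscreteValuationRing A]
    {t : A} (ht : Irreducible t) (a b c : A) (hd : IsUnit (b ^ 2 - 4 * a * c)) (m : ℕ) :
    Module.length (NodalModelRing a b c (t ^ m))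
        (NodalModelRing a b c (t ^ m) ⧸
          Module.fittingIdeal (NodalModelRing a b c (t ^ m))
            (Ω[NodalModelRing a b c (t ^ m)⁄A]) 1) = m := by
  rw [length_quotient_fittingIdeal_nodalModelRing a b c (t ^ m) hd, ← Ideal.span_singleton_pow,
    ← ht.maximalIdeal_eq]
  exact IsDiscreteValuationRing.length_quotient_pow_maximalIdeal A m

end DeJong1996

end Literature.AlgebraicGeometry.Resolution

end
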